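import Literature.AnabelianGeometry.SemiGraphs.PSCGraphicity
import Mathlib.Topology.Algebra.ClopenNhdofOne
import Mathlib.Topology.Instances.ZMod
import HarnessLib

/-!
# [CombGC] Prop. 1.2 (i) for PSC data whose distinct vertices are separated by unramified characters

Mochizuki, *A combinatorial version of the Grothendieck conjecture* [CombGC] §1, Prop. 1.2 (i) p. 8
[cite: MochizukiCombGC2007, Prop 1.2(i) p.8]: for `G` of pro-`Σ` PSC-type and verticial subgroups
`A₁`, `A₂` of vertices `v₁`, `v₂`, "if `A₁ ∩ A₂` is open in `A₁`, then `v₁ = v₂`" (likewise for edges,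
and — `G` sturdy — for the images `Bᵢ` in `Π^unr_G`).  The abc-iut FACT-LIST row F-0459 is the
origin-level statement `OpenInterDeterminesComponentHolds Ω` (`PSCGraphicity.lean`).  This PROOF-ONLY
file (no definitions) isolates a CRITERION on a datum `G : PSCDatum Π` (`Π` profinite) under which the
verticial and unramified cases hold, used by `PSCTwoComponentShape.lean` for the first genuine
MULTI-VERTEX instance of the row (two smooth components meeting at one node):

**vertices separated by unramified characters** — for all vertices `v ≠ w` there are `x ∈ Π_v` and,
for every `n`, a homomorphism `χ : Π → ℤ/ℓⁿ` (`ℓ ≥ 2` fixed) killing `Π_w` and `Ker(Π ↠ Π^unr)` with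
`χ(x) = 1`.  PROFINITE PIGEONHOLE (`not_isOpen_inf_subgroupOf_of_characters`): if `B₁ ∩ B₂` were open
in `B₁ ∋ x` with `B₂ ⊆ Ker χ`, an open normal `N ⊴ Π` would have `N ∩ B₁ ⊆ B₂`, so
`x^[Π:N] ∈ B₂ ⊆ Ker χ`, i.e. `[Π:N] ≡ 0 (mod ℓⁿ)` for EVERY `n` — absurd once `ℓⁿ > [Π:N]`.  Since
characters with commutative target are constant on conjugacy classes, this yields
`VerticialOpenInterDeterminesVertex` and `UnrVerticialOpenInterDeterminesVertex` for the conjugates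
`γᵢ • Π_{vᵢ}` (`⊔ Ker`); with at most one edge the edge-like case is trivial, whence
`openInterDeterminesComponentHolds_of_unrCharacters` (F-0459 at every origin of such data).  Also:
continuous characters killing generators kill the closed subgroups they generate (`cl ι⟨S⟩`,
`Ker(Π ↠ Π^unr)`).  The criterion is met by every tree-shaped stable graph with components of positive
genus (abelian characters of the surface group of the smoothing); it is NOT the printed proof (which is
the commensurator / separating-coverings argument) and says nothing about Prop. 1.2 (ii).  Consistency
evidence for the typed schema; no side is taken on [IUTchIII] Cor. 3.12; typed ≠ proved.
-/

noncomputable section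

namespace Literature.AnabelianGeometry.SemiGraphs

open Multiplicative
open scoped Pointwise

universe u

/-! ### Profinite pigeonhole against characters -/

section Core

variable {P : Type*} [Group P] [TopologicalSpace P] [IsTopologicalGroup P] [CompactSpace P]
  [TotallyDisconnectedSpace P]

/-- **Profinite pigeonhole against characters.**  In a profinite group `P`, let `x ∈ B₁` and suppose
that for every `n` some homomorphism `χ : P → ℤ/ℓⁿ` (`ℓ ≥ 2`) kills `B₂` and maps `x ↦ 1`.  Then
`B₁ ∩ B₂` is NOT open in `B₁`: otherwise an open normal `N ⊴ P` has `N ∩ B₁ ⊆ B₂`, so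
`x^[P:N] ∈ B₂` and `[P:N] ≡ 0 (mod ℓⁿ)` for all `n`. [cite: MochizukiCombGC2007, Prop 1.2(i) p.8] -/
theorem not_isOpen_inf_subgroupOf_of_characters {ℓ : ℕ} (hℓ : 1 < ℓ) (B₁ B₂ : Subgroup P) {x : P}
    (hx : x ∈ B₁)
    (hχ : ∀ n : ℕ, ∃ χ : P →* Multiplicative (ZMod (ℓ ^ n)), B₂ ≤ χ.ker ∧ χ x = ofAdd 1) :
    ¬ IsOpen (((B₁ ⊓ B₂).subgroupOf B₁ : Subgroup B₁) : Set B₁) := by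
  intro hopen
  -- an open set `W ⊆ P` cutting out the open subgroup of `B₁`
  obtain ⟨W, hWo, hW⟩ := isOpen_induced_iff.mp hopen
  have h1W : (1 : P) ∈ W := by
    have h1 : (1 : B₁) ∈ (Subtype.val ⁻¹' W : Set B₁) := by
      rw [hW]; exact Subgroup.one_mem _
    exact h1
  obtain ⟨N, hN⟩ := ProfiniteGrp.exist_openNormalSubgroup_sub_open_nhds_of_one hWo h1W
  haveI : (N : Subgroup P).Normal := N.isNormal'
  haveI : Finite (P ⧸ (N : Subgroup P)) := Subgroup.quotient_finite_of_isOpen _ N.isOpen'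
  have hkpos : 0 < (N : Subgroup P).index := Nat.pos_of_ne_zero Subgroup.index_ne_zero_of_finite
  -- `x ^ [P:N] ∈ N ∩ B₁ ⊆ B₂`
  have hxk : x ^ (N : Subgroup P).index ∈ B₂ := by
    have hxN : x ^ (N : Subgroup P).index ∈ (N : Subgroup P) := Subgroup.pow_index_mem _ x
    have hB : (⟨x ^ (N : Subgroup P).index, B₁.pow_mem hx _⟩ : B₁) ∈
        (((B₁ ⊓ B₂).subgroupOf B₁ : Subgroup B₁) : Set B₁) := by
      rw [← hW]; exact hN hxN
    exact (Subgroup.mem_subgroupOf.mp hB).2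
  -- evaluate a character modulo `ℓ ^ k > k`, `k = [P:N]`
  obtain ⟨χ, hker, hχx⟩ := hχ (N : Subgroup P).index
  have h1 : χ (x ^ (N : Subgroup P).index) = 1 := hker hxk
  rw [map_pow, hχx, ← ofAdd_nsmul, nsmul_eq_mul, mul_one, ofAdd_eq_one] at h1
  have hlt : (N : Subgroup P).index < ℓ ^ (N : Subgroup P).index := Nat.lt_pow_self hℓ
  have hval := congrArg ZMod.val h1
  rw [ZMod.val_natCast, Nat.mod_eq_of_lt hlt, ZMod.val_zero] at hval
  exact hkpos.ne' hval

end Core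

namespace PSCDatum

variable {P : Type u} [Group P] [TopologicalSpace P] [IsTopologicalGroup P] [CompactSpace P]
  [TotallyDisconnectedSpace P]

/-! ### Prop. 1.2 (i) for data whose distinct vertices are separated by unramified characters -/

omit [TopologicalSpace P] [IsTopologicalGroup P] [CompactSpace P] [TotallyDisconnectedSpace P] in
/-- A homomorphism to a commutative group is constant on conjugacy classes: `χ (γ • y) = χ y`.
[cite: MochizukiCombGC2007, Prop 1.2(i) p.8] -/
private theorem map_conjAct_smul_eq_of_comm {M : Type*} [CommGroup M] (χ : P →* M) (γ : ConjAct P) (y : P) :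
    χ (γ • y) = χ y := by
  rw [ConjAct.smul_def, map_mul, map_mul, map_inv, mul_inv_cancel_comm]

omit [TopologicalSpace P] [IsTopologicalGroup P] [CompactSpace P] [TotallyDisconnectedSpace P] in
/-- A conjugate of a subgroup killed by a character is killed. [cite: MochizukiCombGC2007, Prop 1.2(i) p.8] -/
private theorem smul_le_ker {M : Type*} [CommGroup M] (χ : P →* M) (γ : ConjAct P) {A : Subgroup P}
    (hA : A ≤ χ.ker) : γ • A ≤ χ.ker := by
  intro y hy
  obtain ⟨z, hz, rfl⟩ := (Subgroup.mem_smul_pointwise_iff_exists _ _ _).mp hy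
  rw [MonoidHom.mem_ker, map_conjAct_smul_eq_of_comm]
  exact hA hz

/-- **Prop. 1.2 (i), verticial case, for data whose distinct vertices are separated by characters.**
If for all vertices `v ≠ w` there are `x ∈ Π_v` and, for every `n`, a homomorphism `χ : Π → ℤ/ℓⁿ`
(`ℓ ≥ 2`) killing `Π_w` with `χ(x) = 1`, then "`A₁ ∩ A₂` open in `A₁` implies `v₁ = v₂`".
[cite: MochizukiCombGC2007, Prop 1.2(i) p.8] -/
theorem verticialOpenInterDeterminesVertex_of_characters (G : PSCDatum P) {ℓ : ℕ} (hℓ : 1 < ℓ)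
    (hsep : ∀ v w : G.graph.V, v ≠ w → ∃ x ∈ G.vertGp v, ∀ n : ℕ,
      ∃ χ : P →* Multiplicative (ZMod (ℓ ^ n)), G.vertGp w ≤ χ.ker ∧ χ x = ofAdd 1) :
    G.VerticialOpenInterDeterminesVertex := by
  intro v₁ v₂ γ₁ γ₂ hopen
  by_contra hne
  obtain ⟨x, hx, hχ⟩ := hsep v₁ v₂ hne
  refine not_isOpen_inf_subgroupOf_of_characters hℓ (γ₁ • G.vertGp v₁) (γ₂ • G.vertGp v₂)
    (Subgroup.smul_mem_pointwise_smul _ _ _ hx) (fun n => ?_) hopen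
  obtain ⟨χ, hker, hχx⟩ := hχ n
  exact ⟨χ, smul_le_ker χ γ₂ hker, by rw [map_conjAct_smul_eq_of_comm, hχx]⟩

/-- **Prop. 1.2 (i), unramified case, for data whose distinct vertices are separated by UNRAMIFIED
characters** (characters also killing `Ker(Π_G ↠ Π^unr_G)`): "`B₁ ∩ B₂` open in `B₁` implies
`v₁ = v₂`" for the images `Bᵢ = Aᵢ · Ker` (no sturdiness needed for this direction of use; the typed
predicate carries `G.IsSturdy →`). [cite: MochizukiCombGC2007, Prop 1.2(i) p.8] -/
theorem unrVerticialOpenInterDeterminesVertex_of_unrCharacters (G : PSCDatum P) {ℓ : ℕ} (hℓ : 1 < ℓ)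
    (hsep : ∀ v w : G.graph.V, v ≠ w → ∃ x ∈ G.vertGp v, ∀ n : ℕ,
      ∃ χ : P →* Multiplicative (ZMod (ℓ ^ n)),
        G.vertGp w ≤ χ.ker ∧ G.unrKer ≤ χ.ker ∧ χ x = ofAdd 1) :
    G.UnrVerticialOpenInterDeterminesVertex := by
  intro _ v₁ v₂ γ₁ γ₂ hopen
  by_contra hne
  obtain ⟨x, hx, hχ⟩ := hsep v₁ v₂ hne
  refine not_isOpen_inf_subgroupOf_of_characters hℓ (γ₁ • G.vertGp v₁ ⊔ G.unrKer)
    (γ₂ • G.vertGp v₂ ⊔ G.unrKer)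
    (Subgroup.mem_sup_left (Subgroup.smul_mem_pointwise_smul _ _ _ hx)) (fun n => ?_) hopen
  obtain ⟨χ, hker, hK, hχx⟩ := hχ n
  exact ⟨χ, sup_le (smul_le_ker χ γ₂ hker) hK, by rw [map_conjAct_smul_eq_of_comm, hχx]⟩

omit [IsTopologicalGroup P] [CompactSpace P] [TotallyDisconnectedSpace P] in
/-- **Prop. 1.2 (i), edge-like case, with at most one edge**: trivially `e₁ = e₂`.
[cite: MochizukiCombGC2007, Prop 1.2(i) p.8] -/
theorem edgeLikeOpenInterDeterminesEdge_of_subsingleton_edges (G : PSCDatum P)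
    [Subsingleton (G.graph.N ⊕ G.graph.C)] : G.EdgeLikeOpenInterDeterminesEdge :=
  fun e₁ e₂ _ _ _ => Subsingleton.elim e₁ e₂

/-! ### Killing closed subgroups by continuous characters -/

omit [CompactSpace P] [TotallyDisconnectedSpace P] in
/-- A continuous character killing the generators `S ⊆ Γ` kills `cl ι⟨S⟩`.
[cite: MochizukiCombGC2007, Prop 1.2(i) p.8] -/
theorem topologicalClosure_map_closure_le_ker {Γ : Type*} [Group Γ] (ι : Γ →* P) {M : Type*}
    [Group M] [TopologicalSpace M] [DiscreteTopology M] (χ : P →* M) (hχ : Continuous χ)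
    (S : Set Γ) (hS : ∀ s ∈ S, χ (ι s) = 1) :
    ((Subgroup.closure S).map ι).topologicalClosure ≤ χ.ker := by
  refine Subgroup.topologicalClosure_minimal _ ?_ ?_
  · rw [Subgroup.map_le_iff_le_comap, Subgroup.closure_le]
    intro s hs
    simpa only [SetLike.mem_coe, Subgroup.mem_comap, MonoidHom.mem_ker] using hS s hs
  · exact (isClosed_singleton (x := (1 : M))).preimage hχ

omit [CompactSpace P] [TotallyDisconnectedSpace P] in
/-- A continuous character killing `z ∈ Γ` kills `cl ι⟨z⟩`. [cite: MochizukiCombGC2007, Prop 1.2(i) p.8] -/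
theorem topologicalClosure_map_zpowers_le_ker {Γ : Type*} [Group Γ] (ι : Γ →* P) {M : Type*}
    [Group M] [TopologicalSpace M] [DiscreteTopology M] (χ : P →* M) (hχ : Continuous χ)
    (z : Γ) (hz : χ (ι z) = 1) :
    ((Subgroup.zpowers z).map ι).topologicalClosure ≤ χ.ker := by
  rw [Subgroup.zpowers_eq_closure]
  exact topologicalClosure_map_closure_le_ker ι χ hχ {z} fun s hs => by
    rw [Set.mem_singleton_iff.mp hs]; exact hz

omit [CompactSpace P] [TotallyDisconnectedSpace P] in
/-- A continuous character killing every cuspidal and every nodal subgroup kills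
`Ker(Π_G ↠ Π^unr_G)`. [cite: MochizukiCombGC2007, Def 1.1(ii) p.7] -/
theorem unrKer_le_ker (G : PSCDatum P) {M : Type*} [Group M] [TopologicalSpace M]
    [DiscreteTopology M] (χ : P →* M) (hχ : Continuous χ) (hc : ∀ c, G.cuspGp c ≤ χ.ker)
    (he : ∀ e, G.nodeGp e ≤ χ.ker) : G.unrKer ≤ χ.ker := by
  refine Subgroup.topologicalClosure_minimal _ ?_
    ((isClosed_singleton (x := (1 : M))).preimage hχ)
  refine Subgroup.normalClosure_le_normal ?_
  rintro y (hy | hy)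
  · obtain ⟨c, hc'⟩ := Set.mem_iUnion.mp hy
    exact hc c hc'
  · obtain ⟨e, he'⟩ := Set.mem_iUnion.mp hy
    exact he e he'

/-! ### Origin-level form of F-0459 -/

/-- **F-0459 / Prop. 1.2 (i)** at every origin all of whose data are profinite, have at most one edge,
and have distinct vertices separated by unramified characters `Π → ℤ/ℓⁿ` (some `ℓ ≥ 2`, all `n`).
[cite: MochizukiCombGC2007, Prop 1.2(i) p.8] -/
theorem openInterDeterminesComponentHolds_of_unrCharacters (Ω : PSCOrigin.{u})
    (hΩ : ∀ ⦃Q : Type u⦄ [Group Q] [TopologicalSpace Q] [IsTopologicalGroup Q] (G : PSCDatum Q),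
      Ω.IsOfPSCType G → CompactSpace Q ∧ TotallyDisconnectedSpace Q ∧
        Subsingleton (G.graph.N ⊕ G.graph.C) ∧
        ∃ ℓ : ℕ, 1 < ℓ ∧ ∀ v w : G.graph.V, v ≠ w → ∃ x ∈ G.vertGp v, ∀ n : ℕ,
          ∃ χ : Q →* Multiplicative (ZMod (ℓ ^ n)),
            G.vertGp w ≤ χ.ker ∧ G.unrKer ≤ χ.ker ∧ χ x = ofAdd 1) :
    OpenInterDeterminesComponentHolds Ω := by
  intro Q _ _ _ G hG
  obtain ⟨_, _, _, ℓ, hℓ, hsep⟩ := hΩ G hG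
  exact ⟨G.verticialOpenInterDeterminesVertex_of_characters hℓ fun v w hvw => by
      obtain ⟨x, hx, h⟩ := hsep v w hvw
      exact ⟨x, hx, fun n => by obtain ⟨χ, h1, -, h3⟩ := h n; exact ⟨χ, h1, h3⟩⟩,
    G.edgeLikeOpenInterDeterminesEdge_of_subsingleton_edges,
    G.unrVerticialOpenInterDeterminesVertex_of_unrCharacters hℓ hsep⟩

end PSCDatum

end Literature.AnabelianGeometry.SemiGraphs

end
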